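import Summits.Ventures.PercRepro.S1CellCaps
import Summits.Ventures.PercRepro.S1TriangleFive
import Summits.Ventures.PercRepro.S1CoreCapUncond

/-!
# PercRepro — S1 THE CELL `(12, 6)` UNCONDITIONALLY (p2, gen 19; SUBCLAIM-S1 §3 / §6.3)

The capped cell inequality `cellOK10 12 6 10 57` holds by kernel: with LEMMA P's `s₃ ≤ 10` at nullity `6`
(`core_ncard_triangles_le_ten_of_nullity_six`, S1TriangleFive) and p1's UNCONDITIONAL `s₄ ≤ 57` at nullity `6`
(`ncard_fourCircuits_le_fifty_seven_uncond`, S1CoreCapUncond — the kernel per-point table `Q*(0..4) = 0, 1, 4, 5, 8`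
continued by the star step, summed by p3's recursion: NO computed instance), the `e`-free core of rank `12` with
`18` points satisfies C-025 at level `4`. The row-12 package (S1RowTwelveProps) had closed this cell only modulo
the computed `Q*(5) = 11` (`s₄ ≤ 49` with `s₃ ≤ 12`); the exact-integer twin (mining/p2/g19/needs.py) reads the
cell at `0.9672` with `(P, S) = (10, 57)` — the triangle cap pays for the weaker four-circuit cap. After this module
the row `12` rests on the single cell `(12, 5)` alone (`c025_four_twelve_of_cap32` below: `s₄ ≤ 32` at nullity `5`
on every core suffices there, the twin's margin `0.9965`; p1's unconditional table gives `33`, the cell fails at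
`1.0004` with it).

* `cell_twelve_six_uncond` — `cellOK10 12 6 10 57 = true` (decide + kernel);
* **`c025_core_twelve_six`** — the cell `(12, 6)`, unconditional.
Axioms: standard.
-/

open scoped Matroid

namespace PercRepro

namespace S1

open Set

variable {α : Type}

/-- The capped cell `(12, 6)` with `s₃ ≤ 10` and `s₄ ≤ 57`, by kernel. -/
theorem cell_twelve_six_uncond : cellOK10 12 6 10 57 = true := by decide +kernel

/-- **THE CELL `(12, 6)`, UNCONDITIONALLY**: the `e`-free core of rank `12` with `18` points satisfies C-025 at
level `4` — LEMMA P's `s₃ ≤ 10` and the unconditional `s₄ ≤ 57` at nullity `6` in the capped cell inequality. -/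
theorem c025_core_twelve_six (M : Matroid α) [M.Finite] (hR : M.eRank = (12 : ℕ)) (hn : M.E.ncard = 18)
    (hfree : ∀ e ∈ M.E, ∃ A ⊆ M.E \ {e}, e ∉ M.closure A ∧ e ∉ M.closure ((M.E \ {e}) \ A)) :
    ThmN.RLS M 12 4 := by
  have hdd : M.E.encard = M.eRank + ((6 : ℕ) : ℕ∞) := by
    rw [hR, ← M.ground_finite.cast_ncard_eq, hn]
    push_cast
    ring
  have hdd' : M.E.encard = M.eRank + 6 := by rw [hdd]; norm_num
  have hP := core_ncard_triangles_le_ten_of_nullity_six M hfree hdd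
  have hS := ncard_fourCircuits_le_fifty_seven_uncond M hfree hdd'
  exact rls_of_cellOK10 M 12 6 10 57 (by norm_num) hR hn hfree hP hS (by norm_num) cell_twelve_six_uncond

end S1

end PercRepro
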